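import Summits.BirchSwinnertonDyer.Rank1Residual.Supersingular.KuriharaTwistSchemaLevelK
import Mathlib.FieldTheory.Finite.Basic
import Mathlib.Tactic.LinearCombination
import HarnessLib

/-!
# Kurihara twist records — the DEPTH-1 BRIDGE between the two rechecks
# (`TwistRecordK.consistent` at `k = 1` ⟹ `TwistRecord.consistentOdd` of the projection, over a prime `p`)

Cell `b2b-bsdres`, team n1011, seat p09 GEN 3, OWNERS row T-TW3, FILE 3; siblings
`KuriharaTwistSchemaOdd.lean` (FILE 1: predicates `consistentOdd` / `CertifiedOddL` on `TwistRecord`, the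
parent's INVERSE-based recomputation `δ̃ ≡ c_∞⁻¹·D⁻¹·e_ν`) and `KuriharaTwistSchemaLevelK.lean` (FILE 2:
depth-`k` records `TwistRecordK`, MULTIPLICATIVE recheck `e_ν ≡ δ̃·D·c_∞ (mod p^k)`).  Namespace
`Summit.BirchSwinnertonDyer.Rank1Residual.Supersingular.KuriharaTwist`.

HONEST FRAMING (run/shared/lean/b2b/bsd-rank1-residual/, verbatim in every file): the goal of the
cell is to DELETE the COMBINATION-SHAPED residual classes of the Birch–Swinnerton-Dyer formula for
ALL analytic-rank `≤ 1` elliptic curves over `ℚ` — "full BSD formula for every rank `≤ 1` curve in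
class `C`" assembled STRICTLY from published theorems — so that the rank-`≤ 1` remainder becomes
exactly the CONSTRUCTION-SHAPED classes, which are TYPED (missing-input `Prop`s), NOT attempted.
This is not "finishing BSD".  Team n1011 is a RESEARCH ROUTE; this file is schema BOOKKEEPING
(theorems only; no named fact, nothing asserted about any elliptic curve, nothing booked; marks unchanged).

## What this file proves

* `invModPrime_eq` — the naive helpers `powMod` / `invModPrime` of
  `Literature/…/KuriharaCertificates/Schema.lean` compute `b^e mod m` (inline) and `d^{p−2} mod p`;
  `natCast_mul_invModPrime` — Fermat: `d · invModPrime p d = 1` in `ZMod p` for a prime `p ∤ d`.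
* `TwistRecordK.consistentOdd_toTwistRecord` — a consistent depth-`1` record over a PRIME `p` projects
  (`toTwistRecord`) to a `consistentOdd` twist record: guards and structure congruences coincide
  literally; `e_ν ≡ deltaMod·D·c_∞ (mod p)` gives `deltaRecomputed = deltaMod` because `p ∤ D`,
  `p ∤ c_∞ ∈ {1,2}` (`p ≥ 3`) and both sides are `< p`.  Primality is a hypothesis because neither
  recheck tests it (records carry `p` as data; consumers know their `p`).
* `TwistRecordK.nonvanishingOdd_toTwistRecord`, `certifiedOddL_map_toTwistRecord` — hence a `CertifiedK`
  list of depth-1 records projects to a `CertifiedOddL` list: depth-1 data in either format reaches the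
  same consumers.  (The converse direction holds too but is not needed.)

Kept in its own file so that the records files importing the schema files stay free of `Mathlib`
field theory (the schema files elaborate in seconds, as their parents).

References: FILE 1 / FILE 2 and their references [Kim2022StructureSelmer]; seat NOTES.md (n1011-p09 GEN 3).
-/

namespace Summit.BirchSwinnertonDyer.Rank1Residual.Supersingular.KuriharaTwist

section BridgeOne

open Literature.NumberTheory.EllipticCurves.KuriharaCertificates (powMod invModPrime)

/-- `invModPrime p d = d ^ (p - 2) % p` (the naive helpers `powMod` / `invModPrime` of
`KuriharaCertificates/Schema.lean` unfolded; the twin statement for the X11 schema's copy of `powMod` is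
`X11b.powMod_eq` in `X11b/CertificateCheckBridge.lean`, not imported here to keep this file light). [folklore] -/
theorem invModPrime_eq (p d : ℕ) : invModPrime p d = d ^ (p - 2) % p := by
  have h : ∀ b e m : ℕ, powMod b e m = b ^ e % m := by
    intro b e m
    induction e with
    | zero => simp [powMod]
    | succ e ih =>
      unfold powMod at ih ⊢
      rw [List.range_succ, List.foldl_append, List.foldl_cons, List.foldl_nil, ih, Nat.pow_succ,
        Nat.mul_mod (b ^ e % m) b m, Nat.mod_mod, ← Nat.mul_mod]
  unfold invModPrime
  rw [h, ← Nat.pow_mod]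

/-- Fermat: for a prime `p ∤ d`, `d · invModPrime p d = 1` in `ZMod p`. [folklore] -/
theorem natCast_mul_invModPrime (p d : ℕ) [hp : Fact p.Prime] (hd : ¬ p ∣ d) :
    ((d : ZMod p) * ((invModPrime p d : ℕ) : ZMod p)) = 1 := by
  rw [invModPrime_eq, ZMod.natCast_mod, Nat.cast_pow]
  have hd' : (d : ZMod p) ≠ 0 := by
    rwa [Ne, ZMod.natCast_eq_zero_iff]
  have hp2 : 2 ≤ p := hp.out.two_le
  calc (d : ZMod p) * (d : ZMod p) ^ (p - 2) = (d : ZMod p) ^ (p - 1) := by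
        rw [← pow_succ', show p - 2 + 1 = p - 1 by omega]
    _ = 1 := ZMod.pow_card_sub_one_eq_one hd'

/-- The moments of the depth-1 projection are those of the record. [folklore] -/
theorem TwistRecordK.moment_toTwistRecord (r : TwistRecordK) (t : ℕ) :
    r.toTwistRecord.moment t = r.moment t := rfl

/-- The parent's recomputation on the depth-1 projection, unfolded. [folklore] -/
theorem TwistRecordK.deltaRecomputed_toTwistRecord (r : TwistRecordK) :
    r.toTwistRecord.deltaRecomputed =
      (r.moment r.primes.length % (r.p : ℤ)).toNat * invModPrime r.p r.den % r.p
        * invModPrime r.p r.components % r.p := rfl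

/-- **Depth-1 bridge.** A consistent depth-`1` record over a PRIME `p` projects to a `consistentOdd`
twist record of FILE 1: the guards and structure congruences coincide literally, and the multiplicative
recheck `e_ν ≡ deltaMod·D·c_∞ (mod p)` implies the parent's inverse-based recomputation
`deltaRecomputed = deltaMod` by Fermat (`d · d^{p−2} ≡ 1`), since `p ∤ D` and `p ∤ c_∞ ∈ {1, 2}`
(`p ≥ 3`).  Primality is a hypothesis here because neither recheck tests it. [folklore] -/
theorem TwistRecordK.consistentOdd_toTwistRecord {r : TwistRecordK} (hk : r.k = 1) (hp : r.p.Prime)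
    (h : r.consistent = true) : r.toTwistRecord.consistentOdd = true := by
  haveI : Fact r.p.Prime := ⟨hp⟩
  have hmod : r.modulus = r.p := by simp [TwistRecordK.modulus, hk]
  unfold TwistRecordK.consistent at h
  rw [hmod] at h
  simp only [Bool.and_eq_true] at h
  obtain ⟨⟨⟨⟨⟨⟨⟨⟨⟨⟨⟨⟨⟨⟨⟨⟨h1, h2⟩, h3⟩, h4⟩, h5⟩, h6⟩, h7⟩, _⟩, h9⟩, h10⟩, h11⟩, h12⟩, h13⟩, h14⟩, h15⟩,
    h16⟩, h17⟩ := h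
  -- Prop forms of the conjuncts used in the arithmetic
  have h7' : 3 ≤ r.p := of_decide_eq_true h7
  have h11' : r.components = 1 ∨ r.components = 2 := by
    simpa only [Bool.or_eq_true, beq_iff_eq] using h11
  have h13' : ¬ r.p ∣ r.den := by
    rw [Nat.dvd_iff_mod_eq_zero]; simpa only [bne_iff_ne, ne_eq] using h13
  have h15' : r.deltaMod < r.p := of_decide_eq_true h15
  have h17' : (r.moment r.primes.length - ((r.deltaMod * r.den * r.components : ℕ) : ℤ)) % (r.p : ℤ) = 0 := by
    simpa only [beq_iff_eq] using h17
  have hc : ¬ r.p ∣ r.components := by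
    rcases h11' with hc1 | hc2
    · rw [hc1]; intro hd; have := Nat.le_of_dvd one_pos hd; omega
    · rw [hc2]; intro hd; have := Nat.le_of_dvd two_pos hd; omega
  -- the last conjunct: from `e_ν ≡ δ·D·c_∞ (mod p)` to `deltaRecomputed = δ`, in `ZMod p`
  have hE : ((r.moment r.primes.length : ℤ) : ZMod r.p) =
      ((r.deltaMod : ZMod r.p) * (r.den : ZMod r.p)) * (r.components : ZMod r.p) := by
    have hdvd : (r.p : ℤ) ∣ r.moment r.primes.length - ((r.deltaMod * r.den * r.components : ℕ) : ℤ) :=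
      Int.dvd_of_emod_eq_zero h17'
    have := (ZMod.intCast_zmod_eq_zero_iff_dvd _ r.p).2 hdvd
    push_cast at this
    linear_combination this
  have hM : ((((r.moment r.primes.length) % (r.p : ℤ)).toNat : ℕ) : ZMod r.p) =
      ((r.moment r.primes.length : ℤ) : ZMod r.p) := by
    have h0 : (0 : ℤ) ≤ r.moment r.primes.length % (r.p : ℤ) :=
      Int.emod_nonneg _ (by exact_mod_cast hp.ne_zero)
    rw [← Int.cast_natCast (R := ZMod r.p), Int.toNat_of_nonneg h0, ZMod.intCast_mod]
  have key : ((r.toTwistRecord.deltaRecomputed : ℕ) : ZMod r.p) = ((r.deltaMod : ℕ) : ZMod r.p) := by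
    rw [TwistRecordK.deltaRecomputed_toTwistRecord]
    push_cast [ZMod.natCast_mod]
    rw [hM, hE]
    have hden := natCast_mul_invModPrime r.p r.den h13'
    have hcomp := natCast_mul_invModPrime r.p r.components hc
    linear_combination ((r.deltaMod : ZMod r.p) * (r.components : ZMod r.p) *
      ((invModPrime r.p r.components : ℕ) : ZMod r.p)) * hden + (r.deltaMod : ZMod r.p) * hcomp
  have hlt1 : r.toTwistRecord.deltaRecomputed < r.p := by
    rw [TwistRecordK.deltaRecomputed_toTwistRecord]; exact Nat.mod_lt _ hp.pos
  have heq : r.toTwistRecord.deltaRecomputed = r.deltaMod := by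
    have := (ZMod.natCast_eq_natCast_iff' _ _ _).1 key
    rwa [Nat.mod_eq_of_lt hlt1, Nat.mod_eq_of_lt h15'] at this
  have hlast : (r.toTwistRecord.deltaRecomputed == r.toTwistRecord.deltaModP) = true := by
    rw [beq_iff_eq, heq]; rfl
  unfold TwistRecord.consistentOdd
  simp only [Bool.and_eq_true]
  exact ⟨⟨⟨⟨⟨⟨⟨⟨⟨⟨⟨⟨⟨⟨⟨h1, h2⟩, h3⟩, h4⟩, h5⟩, h6⟩, h10⟩, h7⟩, h9⟩, h11⟩, h12⟩, h13⟩, h14⟩, h15⟩,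
    h16⟩, hlast⟩


/-- `nonvanishing` at depth `1` over a prime `p` gives `nonvanishingOdd` of the projection. [folklore] -/
theorem TwistRecordK.nonvanishingOdd_toTwistRecord {r : TwistRecordK} (hk : r.k = 1) (hp : r.p.Prime)
    (h : r.nonvanishing = true) : r.toTwistRecord.nonvanishingOdd = true := by
  simp only [TwistRecordK.nonvanishing, TwistRecord.nonvanishingOdd, Bool.and_eq_true] at h ⊢
  exact ⟨TwistRecordK.consistentOdd_toTwistRecord hk hp h.1, h.2⟩

/-- A `CertifiedK` list of depth-`1` records over primes projects to a `CertifiedOddL` list of FILE 1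
(so depth-1 data in either format reaches the same consumers). [folklore] -/
theorem certifiedOddL_map_toTwistRecord {rs : List TwistRecordK} (h : CertifiedK rs)
    (hk : ∀ r ∈ rs, r.k = 1) (hp : ∀ r ∈ rs, r.p.Prime) :
    CertifiedOddL (rs.map TwistRecordK.toTwistRecord) := by
  refine List.all_eq_true.2 fun r' hr' => ?_
  obtain ⟨r, hr, rfl⟩ := List.mem_map.1 hr'
  exact TwistRecordK.nonvanishingOdd_toTwistRecord (hk r hr) (hp r hr) (h.nonvanishing_of_mem hr)

end BridgeOne

end Summit.BirchSwinnertonDyer.Rank1Residual.Supersingular.KuriharaTwist
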